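import Mathlib
import Literature.Analysis.FluidPDE.VectorCalculus
import Summits.NavierStokesRegularity.NavierStokesRegularity.Theorems.ThreadingFluxErtelTowerLinearFlowTower
import HarnessLib

/-!
# Crux `PoloidalLiouville` (stmt-NavierStokesRegularity-1222, W1), crux idea «radial-jerk-tower» (ns-idea-15 g7):
# INVISCID AFFINE-FLOW RIGIDITY — non-stagnation centres: the drift `v + A(x − x₀)`

Support file (`--supports stmt-NavierStokesRegularity-1222`, helper).  Experiment cell `ns-wall-extremal`, width hand
ns-wall-eng-5 g8, item (ε) E4 (continuation of E1 to centres where the drift does NOT vanish; imports E1 only).  0 kit.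

E1–E3 decide the inviscid shadow about a STAGNATION centre (`u = A(x − x₀)`).  The 1-jet of a general smooth drift at `x₀` is the
AFFINE field `u = v + A(x − x₀)`, `v = u(x₀)`.  Its radial-jerk tower about `x₀` is again explicit and its discriminant
`det(z, ∇θ₁, ∇θ₂)` is an inhomogeneous cubic polynomial in `z = x − x₀` whose TOP-DEGREE PART is the discriminant cubic `D_A` of E1:

* `gradient_biAffine` (`∇⟪p + P z, n + N z⟫ = P†(n + N z) + N†(p + P z)`), `radialJerk_one_affine` (`θ₁ = ⟪v + A z, z⟫`),
  `gradient_thetaOne_affine` (`∇θ₁ = v + (A + A†) z`), `radialJerk_two_affine` (`θ₂ = ⟪v + A z, v + (A + A†) z⟫`),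
  `gradient_thetaTwo_affine` (`∇θ₂ = A†(v + (A+A†)z) + (A+A†)(v + A z)`), `affDisc_eq`;
* `affDisc_line` — along a line `p₀ + t d` the discriminant is a cubic in `t` with LEADING COEFFICIENT `D_A(d)`; hence
  ★ `dense_affDisc_ne_zero`: if `D_A(d) ≠ 0` for one `d`, the affine discriminant is non-zero on a dense set, for EVERY `v`;
* ★ `affineFlowRigidity_of_ne_zero` — if `D_A(d) ≠ 0` for one `d` then for EVERY value `v = u(x₀)` no non-zero smooth field
  frozen into `u = v + A(x − x₀)` on an open space-time set stays tangent to the spheres about `x₀` (`inviscidKinematicRigidity`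
  BY NAME); with E3's classification (file `…LinearFlowDichotomy`, which imports this one) this becomes
  `affineFlowRigidity_of_nonaxisymmetric`: rigid for every `v` as soon as the GRADIENT `A` commutes with no rotation generator;
* ★ `affineFlow_frozen_witness` — conversely, if `A` commutes with `z ↦ w × z` AND `v` is along `w` (`w × v = 0`), then
  `w × (x − x₀)` is a steady frozen sphere-tangent field in `v + A(x − x₀)`.

The remaining class (gradient axisymmetric about `w`, `v` NOT along `w`) is the affine analogue of the (β) stratum of eng-5 g7
(`potentialJerkRigidity_affineQuadratic`: pure trace-free strain ⇒ rigid); with spin it is left to a successor (paper: rigid for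
trace-free `A`; for general trace the rate pattern `(2,2,1)·n` with `v` in the symmetry plane has `det(z,∇θ₁,∇θ₂) ≡ 0`).

HONEST FRAME: statements about the INVISCID AFFINE shadow (prescribed affine drift); helper/information-grade; W1 movement 0;
`PoloidalLiouville` (1222) / (27585) OPEN; NS regularity NOT proved.
-/

-- the summit and its single problem share the name (D-0017 nested layout)
set_option linter.dupNamespace false

noncomputable section

namespace Summit.NavierStokesRegularity.NavierStokesRegularity.Theorems.PoloidalLiouville.ErtelTower

open Set Function Filter Metric
open scoped Topology RealInnerProductSpace InnerProductSpace
open Literature.Analysis.FluidPDE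
open Summit.NavierStokesRegularity.NavierStokesRegularity.Theorems.PoloidalLiouville.HorizonTower (E3)
open Summit.NavierStokesRegularity.NavierStokesRegularity.Theorems.PoloidalLiouville.HorizonTower.Zonal (inner_cross_self_right)

/-! ### Gradients of bi-affine forms -/

section BiAffine

variable (p n : E3) (P N : E3 →L[ℝ] E3) (x₀ : E3)

/-- `D(p + P(y − x₀))(x) = P`. -/
theorem hasFDerivAt_affine (x : E3) : HasFDerivAt (fun y : E3 => p + P (y - x₀)) P x := by
  have h := (hasFDerivAt_clm_sub P x₀ x).const_add p
  exact h

/-- `∇⟪p + P(y−x₀), n + N(y−x₀)⟫(x) = P†(n + N(x − x₀)) + N†(p + P(x − x₀))`. -/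
theorem gradient_biAffine (x : E3) :
    gradient (fun y : E3 => ⟪p + P (y - x₀), n + N (y - x₀)⟫) x =
      (ContinuousLinearMap.adjoint P) (n + N (x - x₀)) + (ContinuousLinearMap.adjoint N) (p + P (x - x₀)) := by
  apply ext_inner_right ℝ
  intro w
  rw [_root_.inner_gradient_left,
    ((hasFDerivAt_affine p P x₀ x).inner ℝ (hasFDerivAt_affine n N x₀ x)).fderiv, inner_add_left,
    ContinuousLinearMap.adjoint_inner_left, ContinuousLinearMap.adjoint_inner_left]
  simp only [ContinuousLinearMap.comp_apply, fderivInnerCLM_apply, ContinuousLinearMap.prod_apply]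
  rw [real_inner_comm (P w)]
  ring

end BiAffine

/-! ### The tower of the affine drift `u = v + A(x − x₀)` -/

section Tower

variable (v : E3) (A : E3 →L[ℝ] E3) (x₀ : E3)

/-- The affine drift is jointly smooth on every `I × U`. -/
theorem contDiffOn_affineDrift {m : WithTop ℕ∞} (I : Set ℝ) (U : Set E3) :
    ContDiffOn ℝ m (uncurry fun (_ : ℝ) (z : E3) => v + A (z - x₀)) (I ×ˢ U) :=
  (contDiff_const.add (A.contDiff.comp (contDiff_snd.sub contDiff_const))).contDiffOn

/-- `D(v + A(y − x₀))(x) = A`. -/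
theorem fderiv_affineDrift (x : E3) : fderiv ℝ (fun y : E3 => v + A (y - x₀)) x = A :=
  (hasFDerivAt_affine v A x₀ x).fderiv

/-- Level 1 of the tower of the affine drift: `θ₁ = ⟪v + A(x − x₀), x − x₀⟫`. -/
theorem radialJerk_one_affine (t : ℝ) :
    radialJerk (fun (_ : ℝ) (z : E3) => v + A (z - x₀)) x₀ 1 t = fun x => ⟪v + A (x - x₀), x - x₀⟫ := by
  funext x
  rw [radialJerk_one]

/-- `∇θ₁ = v + (A + A†)(x − x₀)`. -/
theorem gradient_thetaOne_affine (x : E3) :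
    gradient (fun y : E3 => ⟪v + A (y - x₀), y - x₀⟫) x
      = v + (A (x - x₀) + (ContinuousLinearMap.adjoint A) (x - x₀)) := by
  have h := gradient_biAffine v 0 A (ContinuousLinearMap.id ℝ E3) x₀ x
  simp only [zero_add, ContinuousLinearMap.id_apply, ContinuousLinearMap.adjoint_id] at h
  rw [h]
  abel

/-- Level 2 of the tower of the affine drift: `θ₂ = ⟪v + A(x − x₀), v + (A + A†)(x − x₀)⟫`. -/
theorem radialJerk_two_affine (t : ℝ) :
    radialJerk (fun (_ : ℝ) (z : E3) => v + A (z - x₀)) x₀ 2 t =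
      fun x => ⟪v + A (x - x₀), v + (A + ContinuousLinearMap.adjoint A) (x - x₀)⟫ := by
  funext x
  show deriv (fun s => radialJerk (fun (_ : ℝ) (z : E3) => v + A (z - x₀)) x₀ 1 s x) t
      + ⟪v + A (x - x₀), gradient (radialJerk (fun (_ : ℝ) (z : E3) => v + A (z - x₀)) x₀ 1 t) x⟫
      = ⟪v + A (x - x₀), v + (A + ContinuousLinearMap.adjoint A) (x - x₀)⟫
  have hconst : (fun s : ℝ => radialJerk (fun (_ : ℝ) (z : E3) => v + A (z - x₀)) x₀ 1 s x)
      = fun _ => ⟪v + A (x - x₀), x - x₀⟫ := by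
    funext s; rw [radialJerk_one_affine]
  rw [hconst, deriv_const, zero_add, radialJerk_one_affine, gradient_thetaOne_affine, add_apply]

/-- `∇θ₂ = A†(v + (A + A†)(x − x₀)) + (A + A†)(v + A(x − x₀))`. -/
theorem gradient_thetaTwo_affine (x : E3) :
    gradient (fun y : E3 => ⟪v + A (y - x₀), v + (A + ContinuousLinearMap.adjoint A) (y - x₀)⟫) x =
      (ContinuousLinearMap.adjoint A) (v + (A + ContinuousLinearMap.adjoint A) (x - x₀))
        + (A + ContinuousLinearMap.adjoint A) (v + A (x - x₀)) := by
  -- `A + A†` is self-adjoint (proved inline: this file imports the tower file E1 only)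
  have hsymm : ContinuousLinearMap.adjoint (A + ContinuousLinearMap.adjoint A) = A + ContinuousLinearMap.adjoint A := by
    rw [map_add, ContinuousLinearMap.adjoint_adjoint, add_comm]
  rw [gradient_biAffine, hsymm]

/-- **The discriminant of the affine drift**: at every time,
`⟪x − x₀, ∇θ₁ × ∇θ₂⟫ = ⟪z, (v + (A + A†)z) × (A†(v + (A + A†)z) + (A + A†)(v + A z))⟫`, `z = x − x₀`. -/
theorem affDisc_eq (t : ℝ) (x : E3) :
    ⟪x - x₀, cross (gradient (radialJerk (fun (_ : ℝ) (z : E3) => v + A (z - x₀)) x₀ 1 t) x)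
        (gradient (radialJerk (fun (_ : ℝ) (z : E3) => v + A (z - x₀)) x₀ 2 t) x)⟫ =
      ⟪x - x₀, cross (v + (A + ContinuousLinearMap.adjoint A) (x - x₀))
        ((ContinuousLinearMap.adjoint A) (v + (A + ContinuousLinearMap.adjoint A) (x - x₀))
          + (A + ContinuousLinearMap.adjoint A) (v + A (x - x₀)))⟫ := by
  rw [radialJerk_one_affine, radialJerk_two_affine, gradient_thetaOne_affine, gradient_thetaTwo_affine,
    add_apply]

end Tower

/-! ### Density: the top-degree part of the affine discriminant is the linear discriminant `D_A` -/

section Density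

variable (v w : E3) (M Q R : E3 →L[ℝ] E3)

/-- **Along a line the affine discriminant is a cubic in the parameter whose leading coefficient is the cubic form of E1**:
`⟪p₀ + t d, (v + M(p₀ + t d)) × (w + Q(p₀ + t d))⟫ = ⟪d, M d × Q d⟫ t³ + c₂ t² + c₁ t + c₀`. -/
theorem affDisc_line (p₀ d : E3) : ∃ c₀ c₁ c₂ : ℝ, ∀ t : ℝ,
    ⟪p₀ + t • d, cross (v + M (p₀ + t • d)) (w + Q (p₀ + t • d))⟫ =
      ⟪d, cross (M d) (Q d)⟫ * t ^ 3 + c₂ * t ^ 2 + c₁ * t + c₀ := by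
  refine ⟨⟪p₀, cross (v + M p₀) (w + Q p₀)⟫,
    ⟪d, cross (v + M p₀) (w + Q p₀)⟫ + ⟪p₀, cross (M d) (w + Q p₀)⟫ + ⟪p₀, cross (v + M p₀) (Q d)⟫,
    ⟪d, cross (M d) (w + Q p₀)⟫ + ⟪d, cross (v + M p₀) (Q d)⟫ + ⟪p₀, cross (M d) (Q d)⟫, fun t => ?_⟩
  simp only [map_add, map_smul, ← crossCLM_apply, add_apply, smul_apply, inner_add_left, inner_add_right,
    inner_smul_left, inner_smul_right, RCLike.conj_to_real]
  ring

/-- ★ **If the linear discriminant `⟪d, M d × Q d⟫` is non-zero for ONE direction, the affine discriminant is non-zero on a dense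
set — for every `v, w`** (a cubic in `t` vanishing near `0` has zero leading coefficient, `cubic_leading_eq_zero`). -/
theorem dense_affDisc_ne_zero {d : E3} (hd : ⟪d, cross (M d) (Q d)⟫ ≠ 0) :
    Dense {z : E3 | ⟪z, cross (v + M z) (w + Q z)⟫ ≠ 0} := by
  rw [dense_iff_inter_open]
  intro O hO ⟨p₀, hp₀⟩
  by_contra hempty
  rw [Set.not_nonempty_iff_eq_empty] at hempty
  have hzero : ∀ z ∈ O, ⟪z, cross (v + M z) (w + Q z)⟫ = 0 := by
    intro z hz
    by_contra hne
    have : z ∈ O ∩ {z : E3 | ⟪z, cross (v + M z) (w + Q z)⟫ ≠ 0} := ⟨hz, hne⟩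
    rw [hempty] at this
    exact this
  obtain ⟨r, hr, hball⟩ := Metric.isOpen_iff.mp hO p₀ hp₀
  obtain ⟨c₀, c₁, c₂, hline⟩ := affDisc_line v w M Q p₀ d
  have hδ : 0 < r / (‖d‖ + 1) := by positivity
  have hcubic : ∀ t : ℝ, |t| < r / (‖d‖ + 1) →
      ⟪d, cross (M d) (Q d)⟫ * t ^ 3 + c₂ * t ^ 2 + c₁ * t + c₀ = 0 := by
    intro t ht
    rw [← hline t]
    apply hzero
    apply hball
    rw [Metric.mem_ball, dist_eq_norm, add_sub_cancel_left, norm_smul, Real.norm_eq_abs]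
    have hd1 : 0 < ‖d‖ + 1 := by positivity
    calc |t| * ‖d‖ ≤ |t| * (‖d‖ + 1) := by gcongr; linarith
      _ < r / (‖d‖ + 1) * (‖d‖ + 1) := by gcongr
      _ = r := div_mul_cancel₀ r hd1.ne'
  exact hd (cubic_leading_eq_zero hδ hcubic)

/-- Density survives the translation to the centre. -/
theorem dense_affDisc_ne_zero_sub (x₀ : E3) {d : E3} (hd : ⟪d, cross (M d) (Q d)⟫ ≠ 0) :
    Dense {x : E3 | ⟪x - x₀, cross (v + M (x - x₀)) (w + Q (x - x₀))⟫ ≠ 0} :=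
  (dense_affDisc_ne_zero v w M Q hd).preimage (Homeomorph.subRight x₀).isOpenMap

end Density

/-! ### Rigidity for non-axisymmetric gradients, and the aligned witness -/

section Rigidity

variable (v : E3) (A : E3 →L[ℝ] E3) (x₀ : E3)

/-- ★ **INVISCID AFFINE-FLOW RIGIDITY off the degenerate class.**  If the linear discriminant `D_A` (E1) is non-zero for ONE
direction `d`, then for EVERY centre value `v` every smooth field frozen into the affine drift `u = v + A(x − x₀)`
(`∂ₜB + DB[u] − A B = 0`) on an open `I × U` and tangent to the spheres about `x₀` vanishes identically. -/
theorem affineFlowRigidity_of_ne_zero (B : ℝ → E3 → E3) (I : Set ℝ) (U : Set E3) (hI : IsOpen I) (hU : IsOpen U)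
    (hB : ContDiffOn ℝ (⊤ : ℕ∞) (uncurry B) (I ×ˢ U))
    (hfrozen : ∀ t ∈ I, ∀ x ∈ U, deriv (fun s => B s x) t + fderiv ℝ (B t) x (v + A (x - x₀)) - A (B t x) = 0)
    (htan : ∀ t ∈ I, ∀ x ∈ U, ⟪B t x, x - x₀⟫ = 0) {d : E3}
    (hd : ⟪d, cross ((A + ContinuousLinearMap.adjoint A) d)
      ((ContinuousLinearMap.adjoint A) ((A + ContinuousLinearMap.adjoint A) d)
        + (A + ContinuousLinearMap.adjoint A) (A d))⟫ ≠ 0) :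
    ∀ t ∈ I, ∀ x ∈ U, B t x = 0 := by
  set M : E3 →L[ℝ] E3 := A + ContinuousLinearMap.adjoint A with hM
  set Q : E3 →L[ℝ] E3 := (ContinuousLinearMap.adjoint A).comp M + M.comp A with hQ
  have hQapply : ∀ z, Q z = (ContinuousLinearMap.adjoint A) (M z) + M (A z) := fun z => rfl
  -- the affine discriminant: `⟪z, (v + M z) × (w + Q z)⟫` with `w = A† v + M v`
  have hexp : ∀ z : E3, (ContinuousLinearMap.adjoint A) (v + M z) + M (v + A z)
      = ((ContinuousLinearMap.adjoint A) v + M v) + Q z := fun z => by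
    rw [hQapply, map_add, map_add]; abel
  have hd' : ⟪d, cross (M d) (Q d)⟫ ≠ 0 := by rw [hQapply]; exact hd
  have hdense := dense_affDisc_ne_zero_sub v ((ContinuousLinearMap.adjoint A) v + M v) M Q x₀ hd'
  refine inviscidKinematicRigidity (fun (_ : ℝ) (z : E3) => v + A (z - x₀)) B x₀ I U hI hU
    (contDiffOn_affineDrift v A x₀ I U) hB
    (fun t ht x hx => by rw [fderiv_affineDrift]; exact hfrozen t ht x hx) htan (fun t ht x hx => ?_)
  have hsub : U ∩ {x : E3 | ⟪x - x₀, cross (v + M (x - x₀))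
      (((ContinuousLinearMap.adjoint A) v + M v) + Q (x - x₀))⟫ ≠ 0} ⊆
      {x | x ∈ U ∧ ⟪x - x₀, cross (gradient (radialJerk (fun (_ : ℝ) (z : E3) => v + A (z - x₀)) x₀ 1 t) x)
        (gradient (radialJerk (fun (_ : ℝ) (z : E3) => v + A (z - x₀)) x₀ 2 t) x)⟫ ≠ 0} := by
    rintro y ⟨hyU, hy⟩
    refine ⟨hyU, ?_⟩
    rw [Set.mem_setOf_eq, ← hexp] at hy
    rw [affDisc_eq, ← hM]
    exact hy
  exact closure_mono hsub (hdense.open_subset_closure_inter hU hx)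

/-- ★ **THE ALIGNED WITNESS.**  If `A` commutes with the rotation generator `z ↦ w × z` and the centre value `v` is along `w`
(`w × v = 0`), then `B(x) = w × (x − x₀)` is a steady field frozen into the affine drift `u = v + A(x − x₀)` and tangent to the
spheres about `x₀` (`DB[u] − A B = w × v + (w × A z − A(w × z)) = 0`). -/
theorem affineFlow_frozen_witness (w : E3) (hcomm : ∀ z : E3, A (cross w z) = cross w (A z)) (hv : cross w v = 0) :
    (∀ (t : ℝ) (x : E3), deriv (fun _ : ℝ => cross w (x - x₀)) t
        + fderiv ℝ (fun y : E3 => cross w (y - x₀)) x (v + A (x - x₀)) - A (cross w (x - x₀)) = 0) ∧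
    (∀ x : E3, ⟪cross w (x - x₀), x - x₀⟫ = 0) := by
  refine ⟨fun t x => ?_, fun x => inner_cross_self_right w (x - x₀)⟩
  have hlin : HasFDerivAt (fun y : E3 => cross w (y - x₀)) (crossCLM w) x := by
    have h := hasFDerivAt_clm_sub (crossCLM w) x₀ x
    simpa only [crossCLM_apply] using h
  rw [deriv_const, zero_add, hlin.fderiv, map_add, crossCLM_apply, crossCLM_apply, hv, zero_add, hcomm, sub_self]

end Rigidity

end Summit.NavierStokesRegularity.NavierStokesRegularity.Theorems.PoloidalLiouville.ErtelTower

end
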